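import Summits.BirchSwinnertonDyer.BirchSwinnertonDyer.Theorems.KolyvaginDepthDoorDepthTableRowsExactReadingZhang3
import Summits.BirchSwinnertonDyer.BirchSwinnertonDyer.Theorems.KolyvaginDepthDoorDepthTableRowsTwoSha1
import Summits.BirchSwinnertonDyer.BirchSwinnertonDyer.Theorems.KolyvaginDepthDoorDepthTableRowKitSecondSign
import Summits.BirchSwinnertonDyer.BirchSwinnertonDyer.Theorems.Rank2ObservatoryKernelAnnihilator
import Literature.NumberTheory.EllipticCurves.IrreducibleModPQuadraticTwistProofs
import Literature.NumberTheory.EllipticCurves.NonEisensteinPrimeOfSurjective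
import Literature.NumberTheory.EllipticCurves.LeadingTermProofs
import HarnessLib

/-!
# Route `KolyvaginDepthDoor`, crux `KolyvaginDepthSupplyKN` (stmt-BirchSwinnertonDyer-22820) —
# DEPTH TABLE v12 for the uncertified row `794a1` at `(p, d_K) = (5, −23)`: «ONE BIT ⟺ `rank E = 2` ∧ TWO `Ш`'s»
# — the twist point SUPPLIED IN THE KERNEL, the rank of `E` left in the answer (no 2-descent certificate in the tree)

Helper file of the lead prover of line `levelone` (kdd-p1 g16; `--supports stmt-BirchSwinnertonDyer-22820
--as helper`); it closes nothing and BSD is not proved by it.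

`794a1 = [1, 0, 1, -3, 2]` (`N = 2·397`, ♠ cell, `5` inert in `ℚ(√−23)`) is one of the three depth-table curves
without a kernel 2-descent certificate `Rank2Observatory…TwoDesc…RankTwo` (complex cubic `2`-division field of
discriminant `−1588`, multiplicative at `2`; observatory residual class), so its row of record stays in the v10
form `C794a1.exactRowZhang_5_neg23`: «bit ⟺ `rank E(ℚ) = 2` ∧ `Ш(E/ℚ)[5] = 0` ∧ `#Sel_5(E^{(−23)}/ℚ) ≤ 5`». The
twist side, however, CAN be unpacked now: a residue-sieved search finds the rational point `(416, 7580)` on the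
integer twist model `[0, −23 b₂, 0, 8·23² b₄, −16·23³ b₆] = [0, -23, 0, -21160, -1752048]` (`u = 1/2`-isomorphic to
`E^{(−23)}`, bridge `mordellWeilRank_quadraticTwist_eq_twistModel`), the twist is TORSION-FREE by the annihilator
`t = 1` of the kernel point counts `#Ẽ(𝔽_3) = 6`, `#Ẽ(𝔽_5) = 2`, `#Ẽ(𝔽_7) = 5`, hence `1 ≤ rank E^{(−23)}(ℚ)`
(Mordell–Weil), and `natCard_selmerGroup_le_iff_rank_eq_one_sha₁₅` turns `#Sel_5(E^{(−23)}) ≤ 5` into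
«`rank E^{(−23)} = 1` ∧ `Ш(E^{(−23)})[5] = 0`» (`E^{(−23)}[5]` irreducible as the twist of the onto `ρ̄_{E,5}`):

  «∃ frame, Kolyvagin prime `ℓ`, datum: `c_1(ℓ) ≠ 0`»  `↔`
  «`rank_ℤ E(ℚ) = 2` ∧ `Ш(E/ℚ)[5] = 0` ∧ `rank_ℤ E^{(−23)}(ℚ) = 1` ∧ `Ш(E^{(−23)}/ℚ)[5] = 0`»,

for ANY imaginary quadratic `K` with `d_K = −23`. When the observatory's certificate for `794a1` lands, the first
conjunct drops by `and_iff_right` exactly as in the 15 certified rows. CONDITIONAL on (γ) = Gross 1991 Prop.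
3.7 (2) and W. Zhang 2014 Lemma 8.4 (1) / Thm. 9.1 BY NAME; per curve; BSD is NOT proved by any of this.

References: [WZhang2014] Lemma 8.4 (1) (p. 236), Thm. 9.1 (p. 240); [GrossLMS1991] Prop. 3.7 (2);
[SilvermanAEC2009] VII.3.1 (b), VIII.6.7, X.4.2, X.5 Cor. 5.4; [JetchevLauterStein2009] §3.6 (arXiv:0707.0032);
[CremonaAlgorithms1997] Table 1 (794a1), §3.5.
-/

set_option linter.dupNamespace false

noncomputable section

open scoped Classical NumberField

namespace Summit.BirchSwinnertonDyer.BirchSwinnertonDyer.Theorems.KolyvaginDepthDoor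

open Literature.NumberTheory.EllipticCurves Literature.NumberTheory.EllipticCurves.ModularForms
  WeierstrassCurve NumberField IsDedekindDomain
open Summit.BirchSwinnertonDyer.BirchSwinnertonDyer.Theorems
open Summit.BirchSwinnertonDyer.BirchSwinnertonDyer.Rank2Observatory

/-! ## `794a1` at `(p, d_K) = (5, -23)`: twist model `[0, -23, 0, -21160, -1752048]`, kernel point `(416, 7580)` -/

namespace C794a1

/-- The twist model of `E^{(−23)}` for `E = 794a1`: `[0, −23 b₂, 0, 8·23² b₄, −16·23³ b₆] = [0, -23, 0, -21160, -1752048]`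
(`ℚ`-isomorphic to `E^{(−23)}` by `u = 1/2`). [cite: SilvermanAEC2009, X.5 Cor. 5.4] -/
theorem twistModel_neg23 :
    (⟨0, (-23) * (⟨1, 0, 1, -3, 2⟩ : WeierstrassCurve ℤ).b₂, 0, 8 * (-23) ^ 2 * (⟨1, 0, 1, -3, 2⟩ : WeierstrassCurve ℤ).b₄,
        16 * (-23) ^ 3 * (⟨1, 0, 1, -3, 2⟩ : WeierstrassCurve ℤ).b₆⟩ : WeierstrassCurve ℤ) = ⟨0, -23, 0, -21160, -1752048⟩ := by
  ext <;> decide +kernel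

/-- The twist model `[0, -23, 0, -21160, -1752048]` is an elliptic curve over `ℚ` (`Δ ≠ 0`, kernel-checked). [folklore] -/
theorem isElliptic_twist_neg23 : ((⟨0, -23, 0, -21160, -1752048⟩ : WeierstrassCurve ℤ).map (Int.castRingHom ℚ)).IsElliptic := by
  rw [WeierstrassCurve.isElliptic_iff, WeierstrassCurve.map_Δ, isUnit_iff_ne_zero, eq_intCast,
    Int.cast_ne_zero]
  decide +kernel

/-- Torsion killers for the twist model `[0, -23, 0, -21160, -1752048]`: kernel point counts `(q, #Ṽ(𝔽_q))` at the good
primes `(3, 6), (5, 2), (7, 5)`. [cite: SilvermanAEC2009, Prop. VII.3.1 (b)] -/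
theorem killers_twist_neg23 : ∀ ℓN ∈ [((3 : ℕ), (6 : ℕ)), ((5 : ℕ), (2 : ℕ)), ((7 : ℕ), (5 : ℕ))], ℓN.1.Prime ∧
    ∀ (x : ((⟨0, -23, 0, -21160, -1752048⟩ : WeierstrassCurve ℤ).map (Int.castRingHom ℚ)).toAffine.Point)
      (n : ℕ), ¬ ℓN.1 ∣ n → n • x = 0 → ℓN.2 • x = 0 :=
  killers_cons _ (q := 3) (N := 6) (by decide +kernel) (by decide +kernel)
    (killers_cons _ (q := 5) (N := 2) (by decide +kernel) (by decide +kernel)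
      (killers_cons _ (q := 7) (N := 5) (by decide +kernel) (by decide +kernel)
        (killers_nil _)))

/-- **`E^{(−23)}(ℚ)` is torsion-free** (`E = 794a1`; twist model `[0, -23, 0, -21160, -1752048]`; annihilator `t = 1` from the
kernel counts `(3, 6), (5, 2), (7, 5)`). [cite: SilvermanAEC2009, Prop. VII.3.1 (b)] -/
theorem torsionFree_twist_neg23 (x : ((⟨0, -23, 0, -21160, -1752048⟩ : WeierstrassCurve ℤ).map (Int.castRingHom ℚ)).toAffine.Point)
    (hx : IsOfFinAddOrder x) : x = 0 := by
  simpa only [one_smul] using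
    nsmul_eq_zero_of_annihilatorCheck (t := 1) killers_twist_neg23 (by decide +kernel) hx

/-- **`1 ≤ rank_ℤ E^{(−23)}(ℚ)` for `E = 794a1` IN THE KERNEL**: the rational point `(416, 7580)` of the twist
model `[0, -23, 0, -21160, -1752048]` (residue-sieved search) is non-zero on a torsion-free curve, hence of infinite order;
Mordell–Weil. [cite: SilvermanAEC2009, Prop. VII.3.1 (b) and Thm. VIII.6.7] -/
theorem one_le_rank_twist_neg23 :
    1 ≤ ((⟨0, -23, 0, -21160, -1752048⟩ : WeierstrassCurve ℤ).map (Int.castRingHom ℚ)).mordellWeilRank := by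
  haveI := isElliptic_twist_neg23
  have hP : ((⟨0, -23, 0, -21160, -1752048⟩ : WeierstrassCurve ℤ).map (Int.castRingHom ℚ)).toAffine.Nonsingular
      ((416 : ℚ)) ((7580 : ℚ)) :=
    WeierstrassCurve.Affine.equation_iff_nonsingular.mp
      ((WeierstrassCurve.Affine.equation_iff _ _).mpr (by norm_num [WeierstrassCurve.map]))
  exact one_le_mordellWeilRank_of_not_isOfFinAddOrder _
    (((⟨0, -23, 0, -21160, -1752048⟩ : WeierstrassCurve ℤ).map (Int.castRingHom ℚ)).module_finite_point_holds)
    (fun hfin ↦ WeierstrassCurve.Affine.Point.some_ne_zero hP (torsionFree_twist_neg23 _ (by convert hfin)))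

/-- **DEPTH-TABLE ROW `794a1`, `(p, d_K) = (5, −23)`, v12 modulo the rank of `E` — «ONE BIT ⟺ `rank E = 2` ∧ TWO `Ш`'s».**
For `E = 794a1` and ANY imaginary quadratic `K` with `d_K = −23`: «some frame, some Kolyvagin prime `ℓ`, some datum
of conductor `ℓ` with `c_1(ℓ) ≠ 0`» `↔` «`rank_ℤ E(ℚ) = 2` ∧ `Ш(E/ℚ)[5] = 0` ∧ `rank_ℤ E^{(−23)}(ℚ) = 1` ∧
`Ш(E^{(−23)}/ℚ)[5] = 0`». From the v10 row `C794a1.exactRowZhang_5_neg23` and `natCard_selmerGroup_le_iff_rank_eq_one_sha₁₅`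
at the twist, fed with the kernel point `one_le_rank_twist_neg23` (through `mordellWeilRank_quadraticTwist_eq_twistModel`)
and the irreducibility of `E^{(−23)}[5]` (twist of the onto `ρ̄_{E,5}`). The `rank E = 2` conjunct stays (no 2-descent
certificate for `794a1` in the tree; `2 ≤ rank` is `KernelCerts002.C794a1.two_le_rank`). CONDITIONAL on (γ) and
W. Zhang's Lemma 8.4 (1) / Thm. 9.1 by name; per curve; BSD is not proved by it.
[cite: WZhang2014, Lemma 8.4 (1) (p. 236), Thm. 9.1 (p. 240)] [cite: GrossLMS1991, Prop. 3.7 (2)]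
[cite: SilvermanAEC2009, Thm. X.4.2] [cite: CremonaAlgorithms1997, Table 1 (794a1)] -/
theorem exactRowZhang_5_neg23_twoShaModRank
    (h372 : GrossLMS1991.prop37_2_frobeniusCongruence)
    (h84 : Literature.NumberTheory.EllipticCurves.WZhang2014_lemma84_exists_minimal_kolyvaginClass_one_selmerCard)
    (K : Type) [Field K] [NumberField K] (hK : IsImaginaryQuadratic K)
    (hD : NumberField.discr K = -23) :
    haveI := isElliptic_c794a1;
    haveI := isGloballyMinimal_c794a1;
    haveI : NeZero (((⟨1, 0, 1, -3, 2⟩ : WeierstrassCurve ℤ).map (Int.castRingHom ℚ)).conductorNorm ℤ) := neZero_conductorNorm_of_isElliptic _;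
    haveI := Fact.mk (by norm_num : Nat.Prime 5);
    (∃ (Dt : ModularParametrizationData ((⟨1, 0, 1, -3, 2⟩ : WeierstrassCurve ℤ).map (Int.castRingHom ℚ)) (((⟨1, 0, 1, -3, 2⟩ : WeierstrassCurve ℤ).map (Int.castRingHom ℚ)).conductorNorm ℤ)) (β : ℤ)
      (ι : K →+* ℂ) (ℓ : ℕ) (d : KolyvaginHeegnerData Dt β ι ℓ),
      ℓ.Prime ∧ Zhang2014.IsKolyvaginPrime (((⟨1, 0, 1, -3, 2⟩ : WeierstrassCurve ℤ).map (Int.castRingHom ℚ)).conductorNorm ℤ) ((⟨1, 0, 1, -3, 2⟩ : WeierstrassCurve ℤ).map (Int.castRingHom ℚ)) K 5 ℓ ∧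
        d.kolyvaginClass (p := 5) (by norm_num) 1 ≠ 0) ↔
    (((⟨1, 0, 1, -3, 2⟩ : WeierstrassCurve ℤ).map (Int.castRingHom ℚ)).mordellWeilRank = 2 ∧
      (((⟨1, 0, 1, -3, 2⟩ : WeierstrassCurve ℤ).map (Int.castRingHom ℚ)).sha ⊓ AddSubgroup.torsionBy ((⟨1, 0, 1, -3, 2⟩ : WeierstrassCurve ℤ).map (Int.castRingHom ℚ)).galH1 ((5 : ℕ) : ℤ) : AddSubgroup _) = ⊥ ∧
      (((⟨1, 0, 1, -3, 2⟩ : WeierstrassCurve ℤ).map (Int.castRingHom ℚ)).quadraticTwist (NumberField.discr K : ℚ)).mordellWeilRank = 1 ∧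
      ((((⟨1, 0, 1, -3, 2⟩ : WeierstrassCurve ℤ).map (Int.castRingHom ℚ)).quadraticTwist (NumberField.discr K : ℚ)).sha ⊓
          AddSubgroup.torsionBy (((⟨1, 0, 1, -3, 2⟩ : WeierstrassCurve ℤ).map (Int.castRingHom ℚ)).quadraticTwist (NumberField.discr K : ℚ)).galH1 ((5 : ℕ) : ℤ) :
          AddSubgroup (((⟨1, 0, 1, -3, 2⟩ : WeierstrassCurve ℤ).map (Int.castRingHom ℚ)).quadraticTwist (NumberField.discr K : ℚ)).galH1) = ⊥) := by
  haveI := isElliptic_c794a1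
  haveI := isGloballyMinimal_c794a1
  haveI : NeZero (((⟨1, 0, 1, -3, 2⟩ : WeierstrassCurve ℤ).map (Int.castRingHom ℚ)).conductorNorm ℤ) := neZero_conductorNorm_of_isElliptic _
  haveI := Fact.mk (by norm_num : Nat.Prime 5)
  have hdK : (NumberField.discr K : ℚ) ≠ 0 := by exact_mod_cast NumberField.discr_ne_zero K
  haveI := ((⟨1, 0, 1, -3, 2⟩ : WeierstrassCurve ℤ).map (Int.castRingHom ℚ)).isElliptic_quadraticTwist hdK
  have hsur : ((⟨1, 0, 1, -3, 2⟩ : WeierstrassCurve ℤ).map (Int.castRingHom ℚ)).HasSurjectiveModNGaloisRep (5 ^ 1 : ℕ) := hasSurjectiveModNGaloisRep_pow_5 1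
  rw [pow_one] at hsur
  have hirrT : (((⟨1, 0, 1, -3, 2⟩ : WeierstrassCurve ℤ).map (Int.castRingHom ℚ)).quadraticTwist (NumberField.discr K : ℚ)).HasIrreducibleModPGaloisRep 5 :=
    (((⟨1, 0, 1, -3, 2⟩ : WeierstrassCurve ℤ).map (Int.castRingHom ℚ)).hasIrreducibleModPGaloisRep_quadraticTwist_iff hdK 5).mpr
      (hasIrreducibleModPGaloisRep_of_hasSurjectiveModNGaloisRep ((⟨1, 0, 1, -3, 2⟩ : WeierstrassCurve ℤ).map (Int.castRingHom ℚ)) 5 hsur)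
  have h1 : 1 ≤ (((⟨1, 0, 1, -3, 2⟩ : WeierstrassCurve ℤ).map (Int.castRingHom ℚ)).quadraticTwist (NumberField.discr K : ℚ)).mordellWeilRank := by
    rw [hD, mordellWeilRank_quadraticTwist_eq_twistModel intModel (-23), twistModel_neg23]
    exact one_le_rank_twist_neg23
  exact (exactRowZhang_5_neg23 h372 h84 K hK hD).trans
    (and_congr_right fun _ ↦ and_congr_right fun _ ↦ natCard_selmerGroup_le_iff_rank_eq_one_sha₁₅ _ 5 hirrT h1)

end C794a1

end Summit.BirchSwinnertonDyer.BirchSwinnertonDyer.Theorems.KolyvaginDepthDoor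

end
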